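import Summits.CriticalPhenomena.PercolationContinuityZ3.Theorems.PercNearOneGluingNoHeavyLowerTailOneCutFourBlobsLinear
import HarnessLib

/-!
# `NoHeavyLowerTail` holds on every blob structure with at most four blobs

Support file for the crux `NoHeavyLowerTail` (stmt-CriticalPhenomena-4575; routes `PercNearOneGluing`,
`PercNearOneGluingNoHeavy`), BLOB-QUOTIENT analysis (depth prover nh-dp-blobmono): the crux statement itself,
with its quantifiers `∀ ε ∃ δ ∀ (graph, A, o)`, restricted to the weighted graphs `(n, w, A, o)` that carry a
blob structure with at most four blobs on `insert o A` (same label ⇒ joined almost surely), is a THEOREM: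
`noHeavyLowerTail_fourBlobs` (`δ := ε/3`, uniformly in `|A|` and in the weights).  It follows from the
unconditional one-cut bound with constant `3/2` for four blobs (`Theorems.oneCut_of_fourBlobs_threeHalves`)
exactly as the crux follows from the one-cut bound (`Theorems.noHeavyLowerTail_of_oneCut`): with `δ = ε/3` the
threshold `δ·E N/ε = E N/3 ≤ E N/2` and the pairwise cuts are `< δ`, so the lower-tail mass is `≤ (3/2)δ < ε`.
The reach hypothesis `P(o ↔ A) > 1 − δ` is not used.  Consequently no counterexample to the crux has fewer than
five blobs ("two blobs" is the census's tight template; a refuting family needs many light blobs).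
-/

noncomputable section

namespace Summit.CriticalPhenomena.PercolationContinuityZ3.Theorems

open MeasureTheory Set Literature.Probability.LatticeModels Literature.Probability.Percolation
open scoped Classical BigOperators

/-- **`NoHeavyLowerTail` on four-blob structures.**  For every `ε > 0`, with `δ = ε/3`: for every finite
weighted graph, relay set `A`, observer `o` and blob structure `cls : Fin n → Fin 4` on `insert o A`, if
`P(a ↔ a') > 1 − δ` for all `a, a' ∈ A` then `P(1 ≤ N < (δ/ε)·E N) < ε` — the crux's conclusion, verbatim,
on this class (the hypothesis `P(o ↔ A) > 1 − δ` is not needed). [folklore] -/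
theorem noHeavyLowerTail_fourBlobs :
    ∀ ε : ℝ, 0 < ε → ∃ δ : ℝ, 0 < δ ∧ ∀ (n : ℕ) (w : Sym2 (Fin n) → unitInterval) (A : Finset (Fin n))
      (o : Fin n) (cls : Fin n → Fin 4),
      (∀ u ∈ insert o A, ∀ v ∈ insert o A, cls u = cls v →
        (Literature.Probability.LatticeModels.prodBernoulli w).real
          (Literature.Probability.Percolation.openConn u v)ᶜ = 0) →
      (∀ a ∈ A, ∀ a' ∈ A, 1 - δ < (Literature.Probability.LatticeModels.prodBernoulli w).real
        (Literature.Probability.Percolation.openConn a a')) →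
      (Literature.Probability.LatticeModels.prodBernoulli w).real
        {ω | 1 ≤ (A.filter fun a => ω ∈ Literature.Probability.Percolation.openConn o a).card ∧
          ((A.filter fun a => ω ∈ Literature.Probability.Percolation.openConn o a).card : ℝ) <
            δ * (∑ a ∈ A, (Literature.Probability.LatticeModels.prodBernoulli w).real
              (Literature.Probability.Percolation.openConn o a)) / ε} < ε := by
  intro ε hε
  refine ⟨ε / 3, by positivity, ?_⟩
  intro n w A o cls hcls hpair
  set μ := prodBernoulli w with hμ
  have ht : ∀ a ∈ A, ∀ a' ∈ A, a ≠ a' → μ.real (openConn a a')ᶜ ≤ ε / 3 := by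
    intro a ha a' ha' _
    rw [probReal_compl_eq_one_sub (measurableSet_openConn_holds a a')]
    linarith [hpair a ha a' ha']
  have key := oneCut_of_fourBlobs_threeHalves n w A o (ε / 3) cls hcls (by positivity) ht
  have hEN : 0 ≤ ∑ a ∈ A, μ.real (openConn o a) := Finset.sum_nonneg fun a _ => measureReal_nonneg
  have hsub : {ω : BondConfig (Fin n) | 1 ≤ (A.filter fun a => ω ∈ openConn o a).card ∧
        ((A.filter fun a => ω ∈ openConn o a).card : ℝ) <
          ε / 3 * (∑ a ∈ A, μ.real (openConn o a)) / ε} ⊆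
      {ω : BondConfig (Fin n) | 1 ≤ (A.filter fun a => ω ∈ openConn o a).card ∧
        ((A.filter fun a => ω ∈ openConn o a).card : ℝ) < (∑ a ∈ A, μ.real (openConn o a)) / 2} := by
    intro ω hω
    simp only [Set.mem_setOf_eq] at hω ⊢
    refine ⟨hω.1, lt_of_lt_of_le hω.2 ?_⟩
    have hthr : ε / 3 * (∑ a ∈ A, μ.real (openConn o a)) / ε = (∑ a ∈ A, μ.real (openConn o a)) / 3 := by
      field_simp
    rw [hthr]
    linarith
  calc μ.real _ ≤ μ.real {ω : BondConfig (Fin n) | 1 ≤ (A.filter fun a => ω ∈ openConn o a).card ∧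
          ((A.filter fun a => ω ∈ openConn o a).card : ℝ) < (∑ a ∈ A, μ.real (openConn o a)) / 2} :=
        measureReal_mono hsub
    _ ≤ 3 / 2 * (ε / 3) := key
    _ < ε := by linarith

/-- **`NoHeavyLowerTail` on three-blob structures** (`δ := ε/2`, via the constant-1 bound
`Theorems.oneCut_of_threeBlobs`). [folklore] -/
theorem noHeavyLowerTail_threeBlobs :
    ∀ ε : ℝ, 0 < ε → ∃ δ : ℝ, 0 < δ ∧ ∀ (n : ℕ) (w : Sym2 (Fin n) → unitInterval) (A : Finset (Fin n))
      (o : Fin n) (cls : Fin n → Fin 3),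
      (∀ u ∈ insert o A, ∀ v ∈ insert o A, cls u = cls v →
        (Literature.Probability.LatticeModels.prodBernoulli w).real
          (Literature.Probability.Percolation.openConn u v)ᶜ = 0) →
      (∀ a ∈ A, ∀ a' ∈ A, 1 - δ < (Literature.Probability.LatticeModels.prodBernoulli w).real
        (Literature.Probability.Percolation.openConn a a')) →
      (Literature.Probability.LatticeModels.prodBernoulli w).real
        {ω | 1 ≤ (A.filter fun a => ω ∈ Literature.Probability.Percolation.openConn o a).card ∧
          ((A.filter fun a => ω ∈ Literature.Probability.Percolation.openConn o a).card : ℝ) <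
            δ * (∑ a ∈ A, (Literature.Probability.LatticeModels.prodBernoulli w).real
              (Literature.Probability.Percolation.openConn o a)) / ε} < ε := by
  intro ε hε
  refine ⟨ε / 2, by positivity, ?_⟩
  intro n w A o cls hcls hpair
  set μ := prodBernoulli w with hμ
  have ht : ∀ a ∈ A, ∀ a' ∈ A, a ≠ a' → μ.real (openConn a a')ᶜ ≤ ε / 2 := by
    intro a ha a' ha' _
    rw [probReal_compl_eq_one_sub (measurableSet_openConn_holds a a')]
    linarith [hpair a ha a' ha']
  have key := oneCut_of_threeBlobs n w A o (ε / 2) cls hcls (by positivity) ht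
  have hEN : 0 ≤ ∑ a ∈ A, μ.real (openConn o a) := Finset.sum_nonneg fun a _ => measureReal_nonneg
  have hsub : {ω : BondConfig (Fin n) | 1 ≤ (A.filter fun a => ω ∈ openConn o a).card ∧
        ((A.filter fun a => ω ∈ openConn o a).card : ℝ) <
          ε / 2 * (∑ a ∈ A, μ.real (openConn o a)) / ε} ⊆
      {ω : BondConfig (Fin n) | 1 ≤ (A.filter fun a => ω ∈ openConn o a).card ∧
        ((A.filter fun a => ω ∈ openConn o a).card : ℝ) < (∑ a ∈ A, μ.real (openConn o a)) / 2} := by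
    intro ω hω
    simp only [Set.mem_setOf_eq] at hω ⊢
    refine ⟨hω.1, lt_of_lt_of_le hω.2 (le_of_eq ?_)⟩
    field_simp
  calc μ.real _ ≤ μ.real {ω : BondConfig (Fin n) | 1 ≤ (A.filter fun a => ω ∈ openConn o a).card ∧
          ((A.filter fun a => ω ∈ openConn o a).card : ℝ) < (∑ a ∈ A, μ.real (openConn o a)) / 2} :=
        measureReal_mono hsub
    _ ≤ ε / 2 := key
    _ < ε := by linarith

end Summit.CriticalPhenomena.PercolationContinuityZ3.Theorems

end
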